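import Summits.QuantumFields.BalabanUV.T4Continuum.Support.NE7BoxReflection
import HarnessLib

/-!
# NE7 — THE REFLECTION DOUBLING OF A BOX, II: THE CURL OF THE PULLBACK IS A BOX CURL OR ZERO, ITS TORUS DIVERGENCE IS EXACTLY THE
# FREE-BOUNDARY DIVERGENCE OF THE BOX FIELD AT THE FOLDED SITE, AND THE PACKAGED EXISTENCE OF THE DOUBLING (F308b)

Cell `pub-balaban`, rung (B)+1 sub-cell t4, lineage `b2b-balaban-t4-ne7-p1` (CRUX PROVER NE7 #1 = OWNER of row NE7), generation 93; memo
`t4/b2b-balaban-t4-ne7-p1-g93/UHLENBECK-ROAD.md` §1.  Over F308a `NE7BoxReflection` (the zigzag `f`, the fold `Φ`, the pullback `Ã`, as hypotheses).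

WHAT ([folklore] lattice bookkeeping; 0 def, 0 sorry):
* **`norm_curl_pull_le`** — if `‖dA(q;μ,ν)‖ ≤ C` for every plaquette with its four corners in the box, then `‖dÃ(x;μ,ν)‖ ≤ C` at every
  `x ∈ ℤᵈ`, `μ ≠ ν` (nine cases of the two fold steps: the pulled plaquette is a box plaquette up to orientation, or degenerate).
* **`div_pull_eq`** — `Σ_κ [Ã(x)_κ − Ã(x − e_κ)_κ] = Σ_κ [𝟙(y + e_κ ∈ box) A(y)_κ − 𝟙(y − e_κ ∈ box) A(y − e_κ)_κ]`, `y = Φ x` (six cases of two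
  consecutive fold steps): the Neumann (free-boundary) divergence, the bonds leaving the box absent and never doubled.
* **`exists_box_reflection`** — THE PACKAGE consumed downstream: for `M ≥ 2` and every box `lo + [0,M)ᵈ` there are a fold `Φ : ℤᵈ → box`
  (identity on the box) and a doubling operator `R` on bond fields such that, for every `A`: `R A` is `2M`-periodic, equals `A` on the box bonds,
  vanishes on the straddling bonds `(lo + (M−1)e_μ, μ)`, is bounded by the sup of `A` over the box bonds, has every curl bounded by the sup of
  the box curls of `A`, has torus divergence = free-boundary divergence of `A` at the fold, and commutes with odd bond maps.
HONEST FRAMING (page 1): pure lattice combinatorics on `ℤᵈ`; nothing of Bałaban's asserted; NE7 NOT PROVED here; spine 0∕9; finite T⁴ rung (B)+1 —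
NOT infinite volume, NOT mass gap, NOT `BetaPertH`, NOT Clay.  No `sorry`; axioms ⊆ {propext, Classical.choice, Quot.sound}.
-/

set_option autoImplicit false

open scoped BigOperators Classical
open Finset

namespace Summit.QuantumFields.BalabanUV.T4Continuum.NE7BoxReflection

open Literature.MathematicalPhysics.QuantumFieldTheory.Balaban1983to89
open B7Prop1Explicit

variable {d : ℕ} {E : Type*} [NormedAddCommGroup E]

section Fold

variable {M : ℕ} {f : ℤ → ℤ}
  (hf : ∀ c : ℤ, f c = if c % (2 * (M : ℤ)) < M then c % (2 * (M : ℤ)) else 2 * M - 1 - c % (2 * (M : ℤ)))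
  {lo : Site d} {Φ : Site d → Site d} (hΦ : ∀ (x : Site d) (i : Fin d), Φ x i = lo i + f (x i - lo i))
  {A Ã : Site d → Fin d → E}
  (hÃ : ∀ (x : Site d) (μ : Fin d), Ã x μ = if f (x μ + 1 - lo μ) - f (x μ - lo μ) = 1 then A (Φ x) μ
    else if f (x μ + 1 - lo μ) - f (x μ - lo μ) = -1 then -A (Φ x - e μ) μ else 0)
include hf hΦ hÃ

/-! ## §1 The curl of the pullback -/

/-- **EVERY LINEAR CURL OF THE PULLBACK IS A BOX CURL (UP TO SIGN) OR ZERO**: if `‖dA(q;μ,ν)‖ ≤ C` for every plaquette with its four corners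
in the box (`C ≥ 0`, `M ≥ 1`), then `‖dÃ(x;μ,ν)‖ ≤ C` at every `x ∈ ℤᵈ`, for every ordered pair `μ ≠ ν`. [folklore] -/
theorem norm_curl_pull_le (hM : 1 ≤ M) {C : ℝ} (hC : 0 ≤ C)
    (hA : ∀ (q : Site d) (μ ν : Fin d), (∀ i, lo i ≤ q i ∧ q i < lo i + M) → (∀ i, lo i ≤ (q + e μ) i ∧ (q + e μ) i < lo i + M) →
      (∀ i, lo i ≤ (q + e ν) i ∧ (q + e ν) i < lo i + M) → (∀ i, lo i ≤ (q + e μ + e ν) i ∧ (q + e μ + e ν) i < lo i + M) →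
      ‖A q μ + A (q + e μ) ν - A (q + e ν) μ - A q ν‖ ≤ C)
    (x : Site d) {μ ν : Fin d} (hμν : μ ≠ ν) :
    ‖Ã x μ + Ã (x + e μ) ν - Ã (x + e ν) μ - Ã x ν‖ ≤ C := by
  set y := Φ x with hy_def
  set sμ : ℤ := f (x μ + 1 - lo μ) - f (x μ - lo μ) with hsμ_def
  set sν : ℤ := f (x ν + 1 - lo ν) - f (x ν - lo ν) with hsν_def
  have hy : ∀ i, lo i ≤ y i ∧ y i < lo i + M := foldPt_mem hf hΦ hM x
  have hfμ : Φ (x + e μ) = y + sμ • e μ := foldPt_add_e hΦ x μ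
  have hfν : Φ (x + e ν) = y + sν • e ν := foldPt_add_e hΦ x ν
  have hsν : f ((x + e μ) ν + 1 - lo ν) - f ((x + e μ) ν - lo ν) = sν := by rw [add_e_apply_ne x hμν.symm]
  have hsμ : f ((x + e ν) μ + 1 - lo μ) - f ((x + e ν) μ - lo μ) = sμ := by rw [add_e_apply_ne x hμν]
  have hfμν : Φ (x + e μ + e ν) = y + sμ • e μ + sν • e ν := by
    rw [foldPt_add_e hΦ, foldPt_add_e hΦ, hsν]
  have hyμ : ∀ i, lo i ≤ (y + sμ • e μ) i ∧ (y + sμ • e μ) i < lo i + M := hfμ ▸ foldPt_mem hf hΦ hM (x + e μ)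
  have hyν : ∀ i, lo i ≤ (y + sν • e ν) i ∧ (y + sν • e ν) i < lo i + M := hfν ▸ foldPt_mem hf hΦ hM (x + e ν)
  have hyμν : ∀ i, lo i ≤ (y + sμ • e μ + sν • e ν) i ∧ (y + sμ • e μ + sν • e ν) i < lo i + M :=
    hfμν ▸ foldPt_mem hf hΦ hM (x + e μ + e ν)
  -- unfold the four pulled bonds
  have e1 : Ã x μ = if sμ = 1 then A y μ else if sμ = -1 then -A (y - e μ) μ else 0 := hÃ x μ
  have e2 : Ã (x + e μ) ν = if sν = 1 then A (y + sμ • e μ) ν else if sν = -1 then -A (y + sμ • e μ - e ν) ν else 0 := by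
    rw [hÃ, hsν, hfμ]
  have e3 : Ã (x + e ν) μ = if sμ = 1 then A (y + sν • e ν) μ else if sμ = -1 then -A (y + sν • e ν - e μ) μ else 0 := by
    rw [hÃ, hsμ, hfν]
  have e4 : Ã x ν = if sν = 1 then A y ν else if sν = -1 then -A (y - e ν) ν else 0 := hÃ x ν
  rw [e1, e2, e3, e4]
  rcases step_cases hf hM x μ with hm | hm | hm <;> rcases step_cases hf hM x ν with hn | hn | hn <;>
    rw [← hsμ_def] at hm <;> rw [← hsν_def] at hn <;>
    simp only [hm, hn, if_true, if_false, one_smul, neg_smul, show (-1 : ℤ) ≠ 1 by norm_num, show (0 : ℤ) ≠ 1 by norm_num,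
      show (0 : ℤ) ≠ -1 by norm_num] at hyμ hyν hyμν ⊢
  · -- (1, 1): the plaquette at `y`
    exact hA y μ ν hy hyμ hyν hyμν
  · -- (1, −1): minus the plaquette at `y − e ν`
    have h := hA (y - e ν) μ ν (by rw [sub_eq_add_neg]; exact hyν) (by rw [show y - e ν + e μ = y + e μ + -e ν by abel]; exact hyμν)
      (by rw [sub_add_cancel]; exact hy) (by rw [show y - e ν + e μ + e ν = y + e μ by abel]; exact hyμ)
    rw [show A y μ + -A (y + e μ - e ν) ν - A (y + -e ν) μ - -A (y - e ν) ν
        = -(A (y - e ν) μ + A (y - e ν + e μ) ν - A (y - e ν + e ν) μ - A (y - e ν) ν) by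
      rw [show y + e μ - e ν = y - e ν + e μ by abel, show y + -e ν = y - e ν by abel, sub_add_cancel]; abel, norm_neg]
    exact h
  · -- (1, 0)
    simp [hC]
  · -- (−1, 1): minus the plaquette at `y − e μ`
    have h := hA (y - e μ) μ ν (by rw [sub_eq_add_neg]; exact hyμ) (by rw [sub_add_cancel]; exact hy)
      (by rw [show y - e μ + e ν = y + -e μ + e ν by abel]; exact hyμν) (by rw [show y - e μ + e μ + e ν = y + e ν by abel]; exact hyν)
    rw [show -A (y - e μ) μ + A (y + -e μ) ν - -A (y + e ν - e μ) μ - A y ν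
        = -(A (y - e μ) μ + A (y - e μ + e μ) ν - A (y - e μ + e ν) μ - A (y - e μ) ν) by
      rw [show y + -e μ = y - e μ by abel, show y + e ν - e μ = y - e μ + e ν by abel, sub_add_cancel]; abel, norm_neg]
    exact h
  · -- (−1, −1): the plaquette at `y − e μ − e ν`
    have h := hA (y - e μ - e ν) μ ν (by rw [show y - e μ - e ν = y + -e μ + -e ν by abel]; exact hyμν)
      (by rw [show y - e μ - e ν + e μ = y + -e ν by abel]; exact hyν) (by rw [show y - e μ - e ν + e ν = y + -e μ by abel]; exact hyμ)
      (by rw [show y - e μ - e ν + e μ + e ν = y by abel]; exact hy)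
    rw [show -A (y - e μ) μ + -A (y + -e μ - e ν) ν - -A (y + -e ν - e μ) μ - -A (y - e ν) ν
        = A (y - e μ - e ν) μ + A (y - e μ - e ν + e μ) ν - A (y - e μ - e ν + e ν) μ - A (y - e μ - e ν) ν by
      rw [show y + -e μ - e ν = y - e μ - e ν by abel, show y + -e ν - e μ = y - e μ - e ν by abel,
        show y - e μ - e ν + e μ = y - e ν by abel, show y - e μ - e ν + e ν = y - e μ by abel]; abel]
    exact h
  · -- (−1, 0)
    simp [hC]
  · -- (0, 1)
    simp [hC]
  · -- (0, −1)
    simp [hC]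
  · -- (0, 0)
    simp [hC]

/-! ## §2 The divergence of the pullback -/

/-- **THE TORUS DIVERGENCE OF THE PULLBACK IS THE FREE-BOUNDARY DIVERGENCE OF THE BOX FIELD AT THE FOLDED SITE** (`M ≥ 2`): with `y = Φ x`,
`Σ_κ [Ã(x)_κ − Ã(x − e_κ)_κ] = Σ_κ [𝟙(y + e_κ ∈ box)·A(y)_κ − 𝟙(y − e_κ ∈ box)·A(y − e_κ)_κ]` — the bonds leaving the box are simply absent
(Neumann), never doubled. [folklore] -/
theorem div_pull_eq (hM : 2 ≤ M) (x : Site d) :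
    ∑ κ, (Ã x κ - Ã (x - e κ) κ)
      = ∑ κ, ((if (∀ i, lo i ≤ (Φ x + e κ) i ∧ (Φ x + e κ) i < lo i + M) then A (Φ x) κ else 0)
              - (if (∀ i, lo i ≤ (Φ x - e κ) i ∧ (Φ x - e κ) i < lo i + M) then A (Φ x - e κ) κ else 0)) := by
  have hM1 : 1 ≤ M := by omega
  have hM' : (2 : ℤ) ≤ M := by exact_mod_cast hM
  set y := Φ x with hy_def
  have hy : ∀ i, lo i ≤ y i ∧ y i < lo i + M := foldPt_mem hf hΦ hM1 x
  refine Finset.sum_congr rfl fun κ _ => ?_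
  have hfold : Φ (x - e κ) = y - (f (x κ - lo κ) - f (x κ - 1 - lo κ)) • e κ := foldPt_sub_e hΦ x κ
  have hyκ : y κ = lo κ + f (x κ - lo κ) := hΦ x κ
  have e1 : Ã x κ = if f (x κ - lo κ + 1) - f (x κ - lo κ) = 1 then A y κ
      else if f (x κ - lo κ + 1) - f (x κ - lo κ) = -1 then -A (y - e κ) κ else 0 := by
    rw [hÃ, show x κ + 1 - lo κ = x κ - lo κ + 1 by ring]
  have e2 : Ã (x - e κ) κ = if f (x κ - lo κ) - f (x κ - lo κ - 1) = 1 then A (y - (f (x κ - lo κ) - f (x κ - lo κ - 1)) • e κ) κ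
      else if f (x κ - lo κ) - f (x κ - lo κ - 1) = -1 then -A (y - (f (x κ - lo κ) - f (x κ - lo κ - 1)) • e κ - e κ) κ else 0 := by
    rw [hÃ, hfold, show (x - e κ) κ = x κ - 1 by simp [e_apply], show x κ - 1 + 1 - lo κ = x κ - lo κ by ring,
      show x κ - 1 - lo κ = x κ - lo κ - 1 by ring]
  have hplus : (∀ i, lo i ≤ (y + e κ) i ∧ (y + e κ) i < lo i + M) ↔ f (x κ - lo κ) ≤ (M : ℤ) - 2 := by
    constructor
    · intro h; have h2 := (h κ).2; rw [show (y + e κ) κ = y κ + 1 by simp [e_apply], hyκ] at h2; linarith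
    · intro h i
      by_cases hi : i = κ
      · subst hi; rw [show (y + e i) i = y i + 1 by simp [e_apply], hyκ]
        exact ⟨by linarith [fold_nonneg hf hM1 (x i - lo i)], by linarith⟩
      · rw [add_e_apply_ne y hi]; exact hy i
  have hminus : (∀ i, lo i ≤ (y - e κ) i ∧ (y - e κ) i < lo i + M) ↔ 1 ≤ f (x κ - lo κ) := by
    constructor
    · intro h; have h2 := (h κ).1; rw [show (y - e κ) κ = y κ - 1 by simp [e_apply], hyκ] at h2; linarith
    · intro h i
      by_cases hi : i = κ
      · subst hi; rw [show (y - e i) i = y i - 1 by simp [e_apply], hyκ]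
        exact ⟨by linarith, by linarith [fold_lt hf hM1 (x i - lo i)]⟩
      · rw [sub_e_apply_ne y hi]; exact hy i
  rw [e1, e2]
  rcases fold_triple hf hM (x κ - lo κ) with ⟨h1, h2, h3, h4⟩ | ⟨h1, h2, h3⟩ | ⟨h1, h2, h3⟩ | ⟨h1, h2, h3⟩ | ⟨h1, h2, h3, h4⟩ | ⟨h1, h2, h3⟩ <;>
    simp only [h1, h2, if_true, if_false, one_smul, neg_smul, zero_smul, sub_neg_eq_add, add_sub_cancel_right, sub_zero, zero_sub,
      show (-1 : ℤ) ≠ 1 by norm_num, show (0 : ℤ) ≠ 1 by norm_num, show (0 : ℤ) ≠ -1 by norm_num, show (1 : ℤ) ≠ -1 by norm_num]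
  · rw [if_pos (hplus.2 h4), if_pos (hminus.2 h3)]
  · rw [if_pos (hplus.2 (by rw [h3]; linarith)), if_neg (by rw [hminus]; omega)]; simp
  · rw [if_neg (by rw [hplus]; omega), if_pos (hminus.2 (by rw [h3]; linarith))]; simp
  · rw [if_neg (by rw [hplus]; omega), if_pos (hminus.2 (by rw [h3]; linarith))]; simp
  · rw [if_pos (hplus.2 h4), if_pos (hminus.2 h3)]; abel
  · rw [if_pos (hplus.2 (by rw [h3]; linarith)), if_neg (by rw [hminus]; omega)]; simp

end Fold

/-! ## §3 The packaged doubling -/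

/-- **THE REFLECTION DOUBLING OF A BOX, PACKAGED** (`M ≥ 2`): for the box `lo + [0, M)ᵈ` there are a fold `Φ : ℤᵈ → box`, the identity on the
box, and a doubling operator `R` on bond fields such that for every `A`: `R A` is `2M`-periodic in every direction; `R A = A` on the bonds with both
endpoints in the box; `R A (lo + (M − 1)e_μ)_μ = 0`; `‖R A‖ ≤ a` whenever `‖A‖ ≤ a` on the box bonds; every curl `‖d(RA)(x;μ,ν)‖ ≤ C` (`μ ≠ ν`)
whenever the box curls of `A` are `≤ C`; the lattice divergence of `R A` at `x` is the FREE-BOUNDARY divergence of `A` at `Φ x`; and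
`R (g ∘ A) = g ∘ R A` for every odd `g` with `g 0 = 0`. [folklore] -/
theorem exists_box_reflection {M : ℕ} (hM : 2 ≤ M) (lo : Site d) :
    ∃ (Φ : Site d → Site d) (R : (Site d → Fin d → E) → (Site d → Fin d → E)),
      (∀ (x : Site d) (i : Fin d), lo i ≤ Φ x i ∧ Φ x i < lo i + M) ∧
      (∀ x : Site d, (∀ i, lo i ≤ x i ∧ x i < lo i + M) → Φ x = x) ∧
      ∀ A : Site d → Fin d → E,
        (∀ (x : Site d) (τ μ : Fin d), R A (x + ((2 * M : ℕ) : ℤ) • e τ) μ = R A x μ) ∧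
        (∀ (x : Site d) (μ : Fin d), (∀ i, lo i ≤ x i ∧ x i < lo i + M) → (∀ i, lo i ≤ (x + e μ) i ∧ (x + e μ) i < lo i + M) →
          R A x μ = A x μ) ∧
        (∀ μ : Fin d, R A (lo + ((M : ℤ) - 1) • e μ) μ = 0) ∧
        (∀ a : ℝ, 0 ≤ a → (∀ (y : Site d) (κ : Fin d), (∀ i, lo i ≤ y i ∧ y i < lo i + M) →
            (∀ i, lo i ≤ (y + e κ) i ∧ (y + e κ) i < lo i + M) → ‖A y κ‖ ≤ a) → ∀ (x : Site d) (μ : Fin d), ‖R A x μ‖ ≤ a) ∧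
        (∀ C : ℝ, 0 ≤ C → (∀ (q : Site d) (μ ν : Fin d), (∀ i, lo i ≤ q i ∧ q i < lo i + M) →
            (∀ i, lo i ≤ (q + e μ) i ∧ (q + e μ) i < lo i + M) → (∀ i, lo i ≤ (q + e ν) i ∧ (q + e ν) i < lo i + M) →
            (∀ i, lo i ≤ (q + e μ + e ν) i ∧ (q + e μ + e ν) i < lo i + M) → ‖A q μ + A (q + e μ) ν - A (q + e ν) μ - A q ν‖ ≤ C) →
          ∀ (x : Site d) (μ ν : Fin d), μ ≠ ν → ‖R A x μ + R A (x + e μ) ν - R A (x + e ν) μ - R A x ν‖ ≤ C) ∧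
        (∀ x : Site d, ∑ κ, (R A x κ - R A (x - e κ) κ)
          = ∑ κ, ((if (∀ i, lo i ≤ (Φ x + e κ) i ∧ (Φ x + e κ) i < lo i + M) then A (Φ x) κ else 0)
                  - (if (∀ i, lo i ≤ (Φ x - e κ) i ∧ (Φ x - e κ) i < lo i + M) then A (Φ x - e κ) κ else 0))) ∧
        (∀ g : E → E, g 0 = 0 → (∀ a, g (-a) = -g a) → ∀ (x : Site d) (μ : Fin d), R (fun y κ => g (A y κ)) x μ = g (R A x μ)) := by
  have hM1 : 1 ≤ M := by omega
  -- the zigzag, the fold, the pullback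
  set f : ℤ → ℤ := fun c => if c % (2 * (M : ℤ)) < M then c % (2 * (M : ℤ)) else 2 * M - 1 - c % (2 * (M : ℤ)) with hf_def
  have hf : ∀ c : ℤ, f c = if c % (2 * (M : ℤ)) < M then c % (2 * (M : ℤ)) else 2 * M - 1 - c % (2 * (M : ℤ)) := fun c => rfl
  set Φ : Site d → Site d := fun x i => lo i + f (x i - lo i) with hΦ_def
  have hΦ : ∀ (x : Site d) (i : Fin d), Φ x i = lo i + f (x i - lo i) := fun x i => rfl
  set R : (Site d → Fin d → E) → (Site d → Fin d → E) := fun A x μ =>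
    if f (x μ + 1 - lo μ) - f (x μ - lo μ) = 1 then A (Φ x) μ
    else if f (x μ + 1 - lo μ) - f (x μ - lo μ) = -1 then -A (Φ x - e μ) μ else 0 with hR_def
  have hR : ∀ (A : Site d → Fin d → E) (x : Site d) (μ : Fin d), R A x μ = if f (x μ + 1 - lo μ) - f (x μ - lo μ) = 1 then A (Φ x) μ
      else if f (x μ + 1 - lo μ) - f (x μ - lo μ) = -1 then -A (Φ x - e μ) μ else 0 := fun A x μ => rfl
  refine ⟨Φ, R, foldPt_mem hf hΦ hM1, fun x hx => foldPt_of_mem hf hΦ hx, fun A => ⟨?_, ?_, ?_, ?_, ?_, ?_, ?_⟩⟩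
  · exact fun x τ μ => pull_periodic hf hΦ (hR A) x τ μ
  · exact fun x μ hx hxμ => pull_eq_self hf hΦ (hR A) hx hxμ
  · intro μ
    exact pull_face_eq_zero hf (hR A) hM1 (by rw [add_zsmul_e_apply_self]; ring)
  · exact fun a ha hA x μ => norm_pull_le hf hΦ (hR A) hM1 ha hA x μ
  · exact fun C hC hA x μ ν hμν => norm_curl_pull_le hf hΦ (hR A) hM1 hC hA x hμν
  · exact fun x => div_pull_eq hf hΦ (hR A) hM x
  · intro g h0 hodd x μ
    exact pull_map_odd (hR A) g h0 hodd (B := R (fun y κ => g (A y κ))) (fun x' μ' => hR (fun y κ => g (A y κ)) x' μ') x μ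

end Summit.QuantumFields.BalabanUV.T4Continuum.NE7BoxReflection
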